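import Summits.NavierStokesRegularity.OSWSelfSimilar.SheetRWeakToStrong
import HarnessLib

/-!
# SHEET-ℝ frame: dictionary between the weighted measure `w·dξ` (Mathlib `withDensity`, `Lp`) and the weighted integrals of the certificate frame

HONEST FRAMING (cell ns-blowup GROUP B / zone Z3, case Z3-SR-CERT; 1-D MODEL certificate frame; not Euler/NS; «violates: none — MODEL»).
Nothing here asserts that a profile exists.

Every kernel statement of the SHEET-ℝ frame (`SheetREnergyClass*`, `SheetRWeakToStrong*`, `CertificateViscousSheetRFixedPoint`) speaks of the
weight `w = L² + ξ²` through plain integrals `∫ w·g²`, `∫ w·|f g|`; a concrete MODEL ASSEMBLY over Mathlib will realise the pivot space `L²_w` as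
`Lp ℝ 2 (volume.withDensity w)`.  This file is the dictionary: with `μ_w := volume.withDensity (ξ ↦ ENNReal.ofReal (L² + ξ²))`,
* `integral_withDensity_weight`:  `∫ g dμ_w = ∫ (L² + ξ²)·g`;
* `integrable_withDensity_weight_iff`:  `g ∈ L¹(μ_w) ⇔ (L² + ξ²)·g ∈ L¹`;
* `memLp_two_withDensity_weight_iff`:  `g ∈ L²(μ_w) ⇔ ∫(L² + ξ²)g² < ∞` (for `g` a.e.-strongly measurable);
* `toReal_eLpNorm_two_withDensity_weight`:  `‖g‖_{L²(μ_w)} = (∫(L² + ξ²)g²)^{1/2}` — the `‖·‖_w` of the frame.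
Pure measure theory; no definition, no named fact.  WHAT THIS IS NOT: not NS; not the energy space `E` itself (its packaging is the assembly's choice).
-/

noncomputable section

namespace Summit.NavierStokesRegularity.OSWSelfSimilar
namespace SheetRWeightedMeasure

open _root_.MeasureTheory _root_.Set _root_.Filter
open scoped Real Topology ENNReal

/-- The weight `ξ ↦ L² + ξ²` as an `ℝ≥0∞`-valued density is measurable. [folklore] -/
theorem measurable_weight (L : ℝ) : Measurable fun y : ℝ => ENNReal.ofReal (L ^ 2 + y ^ 2) :=
  ENNReal.measurable_ofReal.comp (by fun_prop)

/-- The density is finite everywhere. [folklore] -/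
theorem weight_lt_top (L : ℝ) : ∀ᵐ y : ℝ, ENNReal.ofReal (L ^ 2 + y ^ 2) < ∞ :=
  Eventually.of_forall fun _ => ENNReal.ofReal_lt_top

/-- `(ofReal (L² + y²)).toReal = L² + y²`. [folklore] -/
theorem toReal_weight (L y : ℝ) : (ENNReal.ofReal (L ^ 2 + y ^ 2)).toReal = L ^ 2 + y ^ 2 :=
  ENNReal.toReal_ofReal (by positivity)

/-- A `volume`-a.e.-strongly measurable function is `μ_w`-a.e.-strongly measurable (`μ_w ≪ volume`). [folklore] -/
theorem aestronglyMeasurable_withDensity_weight {L : ℝ} {g : ℝ → ℝ} (hg : AEStronglyMeasurable g volume) :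
    AEStronglyMeasurable g (volume.withDensity fun y : ℝ => ENNReal.ofReal (L ^ 2 + y ^ 2)) :=
  hg.mono_ac (withDensity_absolutelyContinuous _ _)

/-- **`∫ g dμ_w = ∫ (L² + ξ²)·g`.** [folklore] -/
theorem integral_withDensity_weight (L : ℝ) (g : ℝ → ℝ) :
    ∫ y, g y ∂(volume.withDensity fun y : ℝ => ENNReal.ofReal (L ^ 2 + y ^ 2)) = ∫ y, (L ^ 2 + y ^ 2) * g y := by
  rw [integral_withDensity_eq_integral_toReal_smul (measurable_weight L) (weight_lt_top L)]
  refine integral_congr_ae (Eventually.of_forall fun y => ?_)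
  simp only [toReal_weight, smul_eq_mul]

/-- **`g ∈ L¹(μ_w) ⇔ (L² + ξ²)·g ∈ L¹(volume)`.** [folklore] -/
theorem integrable_withDensity_weight_iff {L : ℝ} {g : ℝ → ℝ} :
    Integrable g (volume.withDensity fun y : ℝ => ENNReal.ofReal (L ^ 2 + y ^ 2)) ↔ Integrable fun y => (L ^ 2 + y ^ 2) * g y := by
  rw [integrable_withDensity_iff (measurable_weight L) (weight_lt_top L)]
  have e : (fun y => g y * (ENNReal.ofReal (L ^ 2 + y ^ 2)).toReal) = fun y => (L ^ 2 + y ^ 2) * g y := by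
    funext y; rw [toReal_weight]; ring
  rw [e]

/-- **`g ∈ L²(μ_w) ⇔ ∫ (L² + ξ²)·g² < ∞`** for `g` a.e.-strongly measurable. [folklore] -/
theorem memLp_two_withDensity_weight_iff {L : ℝ} {g : ℝ → ℝ} (hg : AEStronglyMeasurable g volume) :
    MemLp g 2 (volume.withDensity fun y : ℝ => ENNReal.ofReal (L ^ 2 + y ^ 2)) ↔ Integrable fun y => (L ^ 2 + y ^ 2) * g y ^ 2 := by
  rw [memLp_two_iff_integrable_sq (aestronglyMeasurable_withDensity_weight hg), integrable_withDensity_weight_iff]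

/-- **`‖g‖_{L²(μ_w)} = (∫ (L² + ξ²)·g²)^{1/2}`** — the frame's `‖g‖_w`. [folklore] -/
theorem toReal_eLpNorm_two_withDensity_weight {L : ℝ} {g : ℝ → ℝ}
    (hg : MemLp g 2 (volume.withDensity fun y : ℝ => ENNReal.ofReal (L ^ 2 + y ^ 2))) :
    (eLpNorm g 2 (volume.withDensity fun y : ℝ => ENNReal.ofReal (L ^ 2 + y ^ 2))).toReal
      = Real.sqrt (∫ y, (L ^ 2 + y ^ 2) * g y ^ 2) := by
  rw [hg.eLpNorm_eq_integral_rpow_norm two_ne_zero ENNReal.ofNat_ne_top]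
  have h2 : (2 : ℝ≥0∞).toReal = 2 := by norm_num
  rw [h2]
  have e : (fun a => ‖g a‖ ^ (2 : ℝ)) = fun a => g a ^ 2 := by
    funext a; rw [Real.rpow_two, Real.norm_eq_abs, sq_abs]
  rw [e, integral_withDensity_weight L (fun a => g a ^ 2), Real.sqrt_eq_rpow, ENNReal.toReal_ofReal]
  · norm_num
  · exact Real.rpow_nonneg (integral_nonneg fun y => by positivity) _

/-- The energy norm in the same dictionary: for the pair `(½Ω, Ω₁)` in `L²(μ_w) × L²(μ_w)`,
`‖½Ω‖²_{L²(μ_w)} + ‖Ω₁‖²_{L²(μ_w)} = ∫ (L² + ξ²)(Ω₁² + ¼Ω²) = ‖Ω‖²_E`. [folklore] -/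
theorem energy_eq_weighted_integrals {L : ℝ} {Ω Ω₁ : ℝ → ℝ} (h0 : Integrable fun y => (L ^ 2 + y ^ 2) * Ω y ^ 2)
    (h1 : Integrable fun y => (L ^ 2 + y ^ 2) * Ω₁ y ^ 2) :
    (∫ y, (1 / 2 * Ω y) ^ 2 ∂(volume.withDensity fun y : ℝ => ENNReal.ofReal (L ^ 2 + y ^ 2)))
      + (∫ y, Ω₁ y ^ 2 ∂(volume.withDensity fun y : ℝ => ENNReal.ofReal (L ^ 2 + y ^ 2)))
      = ∫ y, (L ^ 2 + y ^ 2) * (Ω₁ y ^ 2 + 1 / 4 * Ω y ^ 2) := by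
  rw [integral_withDensity_weight, integral_withDensity_weight]
  have e1 : (fun y => (L ^ 2 + y ^ 2) * (1 / 2 * Ω y) ^ 2) = fun y => 1 / 4 * ((L ^ 2 + y ^ 2) * Ω y ^ 2) := by
    funext y; ring
  rw [e1, integral_const_mul, ← integral_const_mul, ← integral_add ((h0.const_mul _)) h1]
  · refine integral_congr_ae (Eventually.of_forall fun y => ?_)
    beta_reduce
    ring

end SheetRWeightedMeasure
end Summit.NavierStokesRegularity.OSWSelfSimilar

end
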